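import Summits.ValiantsHypothesis.ValiantsHypothesis.Theses.RigidMinimalReps
import Summits.ValiantsHypothesis.ValiantsHypothesis.Theorems.RigidMinimalRepsTorusBound
import Summits.ValiantsHypothesis.ValiantsHypothesis.Theorems.RigidMinimalRepsMinimalRepTorusSymmetricCalibration

/-!
# Crux `RigidMinimalReps.MinimalRepTorusSymmetric` (stmt-ValiantsHypothesis-5112) — summit strength

By tree theorems only (no named facts beyond those already used by the route's `closes`):

* `valiantsHypothesis_of_minimalRepTorusSymmetric` — the crux `X = MinimalRepTorusSymmetric` ALONE
  implies the summit `ValiantsHypothesis` (`VP ℂ ≠ VNP ℂ`): the route's deciding theorem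
  `Theses.RigidMinimalReps.closes` needs besides `X` only the sibling crux `TorusBound`, which is the
  tree theorem `RigidMinimalRepsTorusBound.torusBound_proof`.  So every binder of `closes` other than `X`
  is discharged and `X` is (at least) summit-strength.
* `minimalRepTorusSymmetric_iff_grenetOptimalEventually` — in fact `X` is verbatim (up to tree
  theorems) the EXACT eventual value `dc(per_n) = 2ⁿ - 1` (eventual optimality of Grenet's
  representation): `minimalRepTorusSymmetric_iff_grenetLowerEventually` (file `…Calibration.lean`)
  plus Grenet's upper bound `determinantalComplexity_perPoly_le_holds`.
* `expDcLower_of_minimalRepTorusSymmetric` — hence `X` puts `dc(per_n)` in the exponential regime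
  `(3/2)ⁿ ≤ dc(per_n)` eventually (the hypothesis of the route item `ExpDcGlue`), whereas the summit
  needs only a super-quasi-polynomial lower bound: `X` is summit-strength-PLUS.

These are the calibration theorems behind the crux-strategist verdict `no-strategy-short-of-summit`
(census `Cruxes/MinimalRepTorusSymmetric/STRATEGY-CENSUS.md`).
[cite: Grenet2011, Thm. 1] [cite: LandsbergRessayre2017, Thm. 2.8] [cite: Valiant1979]
-/

-- Sub = Summit single-conjunct layout: the duplicated namespace component is mandated by the tree.
set_option linter.dupNamespace false

noncomputable section

namespace Summit.ValiantsHypothesis.ValiantsHypothesis.Theorems.RigidMinimalRepsMinimalRepTorusSymmetric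

open Matrix MvPolynomial Finset
open Literature.Computability.AlgebraicComplexity

/-- **The crux alone decides the summit.**  `MinimalRepTorusSymmetric → ValiantsHypothesis`, by the
route's deciding theorem `closes` with its second binder discharged by the proved `TorusBound`.
[cite: LandsbergRessayre2017, Thm. 2.8] [cite: Valiant1979] -/
theorem valiantsHypothesis_of_minimalRepTorusSymmetric
    (h : Summit.ValiantsHypothesis.ValiantsHypothesis.Theses.RigidMinimalReps.MinimalRepTorusSymmetric) :
    _root_.ValiantsHypothesis :=
  Summit.ValiantsHypothesis.ValiantsHypothesis.Theses.RigidMinimalReps.closes h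
    RigidMinimalRepsTorusBound.torusBound_proof

/-- **The crux is eventual Grenet optimality.**  `MinimalRepTorusSymmetric ↔
∃ n₀, ∀ n ≥ n₀, dc(per_n) = 2ⁿ - 1` (lower bound: `minimalRepTorusSymmetric_iff_grenetLowerEventually`;
upper bound: Grenet). [cite: Grenet2011, Thm. 1] [cite: LandsbergRessayre2017, Thm. 2.8] -/
theorem minimalRepTorusSymmetric_iff_grenetOptimalEventually :
    Summit.ValiantsHypothesis.ValiantsHypothesis.Theses.RigidMinimalReps.MinimalRepTorusSymmetric ↔
    ∃ n₀ : ℕ, ∀ n ≥ n₀, determinantalComplexity (perPoly (Fin n) ℂ) = 2 ^ n - 1 := by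
  rw [minimalRepTorusSymmetric_iff_grenetLowerEventually]
  constructor
  · rintro ⟨n₀, h⟩
    refine ⟨max n₀ 1, fun n hn => le_antisymm ?_ (h n (le_trans (le_max_left _ _) hn))⟩
    exact determinantalComplexity_perPoly_le_holds ℂ n (le_trans (le_max_right _ _) hn)
  · rintro ⟨n₀, h⟩
    exact ⟨n₀, fun n hn => (h n hn).ge⟩

/-- Arithmetic: `(3/2)ⁿ ≤ 2ⁿ - 1` over `ℝ` for `n ≥ 2`. -/
private theorem three_halves_pow_le (n : ℕ) (hn : 2 ≤ n) : ((3 : ℝ) / 2) ^ n ≤ (2 : ℝ) ^ n - 1 := by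
  induction n, hn using Nat.le_induction with
  | base => norm_num
  | succ n hn ih =>
    have h2 : (1 : ℝ) ≤ (2 : ℝ) ^ n := one_le_pow₀ (by norm_num)
    calc ((3 : ℝ) / 2) ^ (n + 1) = (3 / 2) * ((3 : ℝ) / 2) ^ n := by ring
      _ ≤ (3 / 2) * ((2 : ℝ) ^ n - 1) := by
          apply mul_le_mul_of_nonneg_left ih (by norm_num)
      _ ≤ (2 : ℝ) ^ (n + 1) - 1 := by rw [pow_succ]; nlinarith

/-- **Summit-strength-plus.**  The crux puts `dc(per_n)` in the exponential regime:
`∃ c > 1, ∃ n₀, ∀ n ≥ n₀, cⁿ ≤ dc(per_n)` (with `c = 3/2`), i.e. exactly the hypothesis of the route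
item `ExpDcGlue`; the summit itself needs only a super-quasi-polynomial bound.
[cite: Grenet2011, Thm. 1] [cite: LandsbergRessayre2017, Thm. 2.8] -/
theorem expDcLower_of_minimalRepTorusSymmetric
    (h : Summit.ValiantsHypothesis.ValiantsHypothesis.Theses.RigidMinimalReps.MinimalRepTorusSymmetric) :
    ∃ c : ℝ, 1 < c ∧ ∃ n₀ : ℕ, ∀ n ≥ n₀,
      c ^ n ≤ (determinantalComplexity (perPoly (Fin n) ℂ) : ℝ) := by
  obtain ⟨n₀, h⟩ := minimalRepTorusSymmetric_iff_grenetOptimalEventually.1 h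
  refine ⟨3 / 2, by norm_num, max n₀ 2, fun n hn => ?_⟩
  have h1 : 2 ^ n - 1 ≤ determinantalComplexity (perPoly (Fin n) ℂ) :=
    (h n (le_trans (le_max_left _ _) hn)).ge
  have h2 : 2 ≤ n := le_trans (le_max_right _ _) hn
  have hcast : ((2 ^ n - 1 : ℕ) : ℝ) = (2 : ℝ) ^ n - 1 := by
    rw [Nat.cast_sub Nat.one_le_two_pow, Nat.cast_pow]
    norm_num
  calc ((3 : ℝ) / 2) ^ n ≤ (2 : ℝ) ^ n - 1 := three_halves_pow_le n h2
    _ = ((2 ^ n - 1 : ℕ) : ℝ) := hcast.symm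
    _ ≤ (determinantalComplexity (perPoly (Fin n) ℂ) : ℝ) := by exact_mod_cast h1

/-- Packaging for the route: the crux gives BOTH binders of `ExpDcGlue`'s shape, so
`X → ValiantsHypothesis` also factors through the proved glue item `ExpDcGlue`
(`Summit.ValiantsHypothesis.Theorems.expDcGlue_proof`), independently of `closes`.
[cite: Burgisser2000] [cite: Valiant1979] -/
theorem valiantsHypothesis_of_minimalRepTorusSymmetric'
    (hglue : Summit.ValiantsHypothesis.ValiantsHypothesis.Theses.RigidMinimalReps.ExpDcGlue)
    (h : Summit.ValiantsHypothesis.ValiantsHypothesis.Theses.RigidMinimalReps.MinimalRepTorusSymmetric) :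
    _root_.ValiantsHypothesis :=
  hglue (expDcLower_of_minimalRepTorusSymmetric h)

end Summit.ValiantsHypothesis.ValiantsHypothesis.Theorems.RigidMinimalRepsMinimalRepTorusSymmetric

end
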